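import Literature.Probability.RandomPlanarGeometry.RestrictionHullsProofs
import Mathlib.Analysis.Calculus.Darboux
import Mathlib.Analysis.Complex.RealDeriv
import HarnessLib

/-!
# The Schwarz reflection of a restriction map is univalent near `0`

For a `*`-hull `A` and a restriction map `Φ = Φ_A : ℍ ∖ A → ℍ` with `B(0, 2r) ∩ A = ∅`, the
Schwarz reflection `F` of `Φ` across the real segment (`RestrictionHullsProofs`:
`IsRestrictionMap.exists_extension`, `SchwarzReflection.differentiableOn_reflect`) is a
holomorphic function on `B(0, r)` with

* `F = Φ` on `ℍ ∩ B(0, r)`, `F(0) = 0`, `F'(0) = Φ'_A(0)` (the number `HasRestrictionDeriv A Φ d`);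
* `F` is **injective** on `B(0, r)` (`IsRestrictionMap.exists_reflection`): the upper half-disc
  goes to `ℍ`, the lower one to `-ℍ`, the real segment to `ℝ`, injectively on each piece — on
  the segment because `F' ≠ 0` there (`SchwarzReflection.deriv_ne_zero_of_im_pos` at every real
  point) so that `re F` is strictly monotone (Darboux).

This is the input for Koebe-distortion control of `Φ_A` near `0` ([LSW] proof of Lemma 3.5,
p. 12: "`Φ_A` extends analytically to a neighbourhood of `0` by Schwarz reflection").
-/

noncomputable section

open Set Filter Metric Topology Function Complex
open UpperHalfPlane (upperHalfPlaneSet isOpen_upperHalfPlaneSet)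
open scoped ComplexConjugate

namespace Literature.Probability.RandomPlanarGeometry

variable {A : Set ℂ} {Φ : ConformalEquiv (upperHalfPlaneSet \ A) upperHalfPlaneSet} {r : ℝ}

/-- A holomorphic function on a disc about a real point, real on the real points and with
positive imaginary part on the upper half, has nonzero derivative with zero imaginary part at
that real point. [folklore] -/
theorem deriv_reflection_real {F : ℂ → ℂ} (hF : DifferentiableOn ℂ F (ball (0 : ℂ) r))
    (hreal : ∀ t : ℝ, |t| < r → (F t).im = 0)
    (hpos : ∀ z ∈ upperHalfPlaneSet ∩ ball (0 : ℂ) r, 0 < (F z).im) {t : ℝ} (ht : |t| < r) :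
    deriv F t ≠ 0 ∧ (deriv F t).im = 0 := by
  have htball : (t : ℂ) ∈ ball (0 : ℂ) r := by
    rw [mem_ball_zero_iff, Complex.norm_real, Real.norm_eq_abs]; exact ht
  have hFd : HasDerivAt F (deriv F t) t := (hF.differentiableAt (isOpen_ball.mem_nhds htball)).hasDerivAt
  constructor
  · -- translate to `0` and apply `deriv_ne_zero_of_im_pos`
    set ρ : ℝ := r - |t| with hρ
    have hρpos : 0 < ρ := by rw [hρ]; linarith
    set Ft : ℂ → ℂ := fun z ↦ F (t + z) - F t with hFt
    have hsub : ∀ z ∈ ball (0 : ℂ) ρ, (t : ℂ) + z ∈ ball (0 : ℂ) r := fun z hz ↦ by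
      rw [mem_ball_zero_iff] at hz ⊢
      calc ‖(t : ℂ) + z‖ ≤ ‖(t : ℂ)‖ + ‖z‖ := norm_add_le _ _
        _ < |t| + ρ := by rw [Complex.norm_real, Real.norm_eq_abs]; linarith
        _ = r := by rw [hρ]; ring
    have hFtd : DifferentiableOn ℂ Ft (ball (0 : ℂ) ρ) := by
      refine DifferentiableOn.sub_const (hF.comp ((differentiableOn_const _).add differentiableOn_id)
        fun z hz ↦ hsub z hz) _
    have hFt0 : Ft 0 = 0 := by simp [hFt]
    have hFtpos : ∀ z ∈ upperHalfPlaneSet ∩ ball (0 : ℂ) ρ, 0 < (Ft z).im := by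
      rintro z ⟨hz, hzρ⟩
      have h1 : (t : ℂ) + z ∈ upperHalfPlaneSet ∩ ball (0 : ℂ) r := by
        refine ⟨?_, hsub z hzρ⟩
        show 0 < ((t : ℂ) + z).im
        have : 0 < z.im := hz
        simpa using this
      have := hpos _ h1
      rw [hFt]; dsimp only
      rw [Complex.sub_im, hreal t ht, sub_zero]
      exact this
    have hne := SchwarzReflection.deriv_ne_zero_of_im_pos hρpos hFtd hFt0 hFtpos
    have hderiv : deriv Ft 0 = deriv F t := by
      have h1 : HasDerivAt (fun z : ℂ ↦ (t : ℂ) + z) 1 0 := by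
        simpa using (hasDerivAt_id (0 : ℂ)).const_add (t : ℂ)
      have h2 : HasDerivAt F (deriv F t) ((t : ℂ) + 0) := by rw [add_zero]; exact hFd
      have h3 := (h2.comp 0 h1).sub_const (F t)
      rw [mul_one] at h3
      exact h3.deriv
    rwa [hderiv] at hne
  · -- the imaginary part of `F` vanishes along the real axis
    have h1 : HasDerivAt (fun y : ℝ ↦ (F y).im) (deriv F t).im t := by
      have h := (hFd.const_mul (-I)).real_of_complex
      have hfun : (fun y : ℝ ↦ (-I * F y).re) = fun y : ℝ ↦ (F y).im := by
        funext y; simp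
      have hval : (-I * deriv F t).re = (deriv F t).im := by simp
      rwa [hfun, hval] at h
    have h2 : HasDerivAt (fun y : ℝ ↦ (F y).im) 0 t := by
      refine (hasDerivAt_const t (0 : ℝ)).congr_of_eventuallyEq ?_
      have hev : ∀ᶠ y : ℝ in 𝓝 t, |y| < r :=
        (continuous_abs.tendsto t).eventually (Iio_mem_nhds ht)
      filter_upwards [hev] with y hy
      exact hreal y hy
    exact h1.unique h2

/-- **The Schwarz reflection of `Φ_A` is univalent near `0`.** For a `*`-hull `A`, a
restriction map `Φ` of `A` with `Φ'_A(0) = d` and `B(0, 2r) ∩ A = ∅`: there is `F` holomorphic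
and injective on `B(0, r)` with `F = Φ` on `ℍ ∩ B(0, r)`, `F(0) = 0` and `F'(0) = d`.
[cite: LawlerSchrammWerner2003Restriction, proof of Lemma 3.5 (p. 12)] -/
theorem IsRestrictionMap.exists_reflection (hA : IsStarHull A) (hΦ : IsRestrictionMap A Φ)
    {d : ℝ} (hd : HasRestrictionDeriv A Φ d) (hr0 : 0 < r) (hr : Disjoint (ball (0 : ℂ) (2 * r)) A) :
    ∃ F : ℂ → ℂ, DifferentiableOn ℂ F (ball (0 : ℂ) r) ∧ InjOn F (ball (0 : ℂ) r) ∧ F 0 = 0 ∧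
      deriv F 0 = d ∧ EqOn F Φ (upperHalfPlaneSet ∩ ball (0 : ℂ) r) := by
  set W := upperHalfPlaneSet ∩ ball (0 : ℂ) r with hW_def
  have hWΩ : W ⊆ upperHalfPlaneSet \ A := inter_ball_subset_diff hr
  obtain ⟨G, hG, hEq⟩ := hΦ.exists_extension hA hr
  have hGreal : ∀ t : ℝ, |t| < r → (G t).im = 0 := fun t ht ↦ hΦ.extension_ofReal_im hA hr hG hEq ht
  have hG0 : G 0 = 0 := hΦ.extension_zero hr hr0 hG hEq
  set F : ℂ → ℂ := fun z ↦ if 0 ≤ z.im then G z else conj (G (conj z)) with hF_def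
  have hGd : DifferentiableOn ℂ G W := by
    intro z hz
    have hΦd : DifferentiableAt ℂ Φ z :=
      Φ.differentiableOn_coe.differentiableAt
        ((isOpen_upperHalfPlaneSet_diff hA.1.isClosed).mem_nhds (hWΩ hz))
    have hev : Φ =ᶠ[𝓝 z] G := by
      filter_upwards [(isOpen_upperHalfPlaneSet_inter_ball r).mem_nhds hz] with w hw
      exact hEq hw
    exact (hev.differentiableAt_iff.1 hΦd).differentiableWithinAt
  have hF : DifferentiableOn ℂ F (ball (0 : ℂ) r) := SchwarzReflection.differentiableOn_reflect hG hGd hGreal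
  have hF0 : F 0 = 0 := by simp [hF_def, hG0]
  have hFt : ∀ t : ℝ, F t = G t := fun t ↦ by simp [hF_def]
  have hFW : ∀ z ∈ W, F z = Φ z := fun z hz ↦ by
    have hz' : 0 < z.im := hz.1
    rw [hF_def]; simp only [if_pos hz'.le]
    exact (hEq hz).symm
  have hFlow : ∀ z : ℂ, z.im < 0 → F z = conj (G (conj z)) := fun z hz ↦ by
    rw [hF_def]; simp only [if_neg (not_le.2 hz)]
  have hFreal : ∀ t : ℝ, |t| < r → (F t).im = 0 := fun t ht ↦ by rw [hFt]; exact hGreal t ht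
  have hFpos : ∀ z ∈ W, 0 < (F z).im := fun z hz ↦ by rw [hFW z hz]; exact Φ.mapsTo (hWΩ hz)
  -- `F'(0) = d`
  have hderiv : HasDerivAt F (deriv F 0) 0 := (hF.differentiableAt (ball_mem_nhds 0 hr0)).hasDerivAt
  have hslope : Tendsto (fun z ↦ F z / z) (𝓝[≠] 0) (𝓝 (deriv F 0)) := by
    refine (hasDerivAt_iff_tendsto_slope.1 hderiv).congr' (Eventually.of_forall fun z ↦ ?_)
    rw [slope_def_field, hF0, sub_zero, sub_zero]
  have hΩle : 𝓝[upperHalfPlaneSet \ A] (0 : ℂ) ≤ 𝓝[≠] 0 := by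
    refine nhdsWithin_mono _ fun z hz h0 ↦ ?_
    have h0' : z = 0 := h0
    have him : 0 < z.im := hz.1
    rw [h0', zero_im] at him
    exact lt_irrefl _ him
  have hWmem : W ∈ 𝓝[upperHalfPlaneSet \ A] (0 : ℂ) :=
    mem_of_superset (inter_mem_nhdsWithin (upperHalfPlaneSet \ A) (ball_mem_nhds 0 hr0))
      fun z hz ↦ ⟨hz.1.1, hz.2⟩
  have hlim : Tendsto (fun z ↦ Φ z / z) (𝓝[upperHalfPlaneSet \ A] 0) (𝓝 (deriv F 0)) := by
    refine (hslope.mono_left hΩle).congr' ?_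
    filter_upwards [hWmem] with z hz
    rw [hFW z hz]
  haveI : (𝓝[upperHalfPlaneSet \ A] (0 : ℂ)).NeBot :=
    mem_closure_iff_nhdsWithin_neBot.1 hA.zero_mem_closure_diff
  have hdF : deriv F 0 = d := tendsto_nhds_unique hlim hd
  refine ⟨F, hF, ?_, hF0, hdF, fun z hz ↦ hFW z hz⟩
  -- injectivity
  -- (a) `re F` is strictly monotone on the real segment
  have hFd' : ∀ t : ℝ, |t| < r → deriv F t ≠ 0 ∧ (deriv F t).im = 0 := fun t ht ↦
    deriv_reflection_real hF hFreal hFpos ht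
  set φ : ℝ → ℝ := fun y ↦ (F y).re with hφ
  have hφd : ∀ t ∈ Ioo (-r) r, HasDerivAt φ (deriv F t).re t := fun t ht ↦ by
    have htball : (t : ℂ) ∈ ball (0 : ℂ) r := by
      rw [mem_ball_zero_iff, Complex.norm_real, Real.norm_eq_abs]; exact abs_lt.2 ht
    exact ((hF.differentiableAt (isOpen_ball.mem_nhds htball)).hasDerivAt).real_of_complex
  have hφinj : InjOn φ (Ioo (-r) r) := by
    have hne : ∀ t ∈ Ioo (-r) r, (deriv F t).re ≠ 0 := fun t ht h ↦ by
      obtain ⟨h1, h2⟩ := hFd' t (abs_lt.2 ht)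
      exact h1 (Complex.ext (by simpa using h) (by simpa using h2))
    have hcont : ContinuousOn φ (Ioo (-r) r) := fun t ht ↦ (hφd t ht).continuousAt.continuousWithinAt
    have hderivφ : ∀ t ∈ Ioo (-r) r, deriv φ t = (deriv F t).re := fun t ht ↦ (hφd t ht).deriv
    rcases hasDerivWithinAt_forall_lt_or_forall_gt_of_forall_ne (convex_Ioo (-r) r)
      (fun t ht ↦ (hφd t ht).hasDerivWithinAt) (m := 0) hne with hneg | hpos'
    · refine (strictAntiOn_of_deriv_neg (convex_Ioo (-r) r) hcont fun t ht ↦ ?_).injOn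
      rw [interior_Ioo] at ht
      rw [hderivφ t ht]; exact hneg t ht
    · refine (strictMonoOn_of_deriv_pos (convex_Ioo (-r) r) hcont fun t ht ↦ ?_).injOn
      rw [interior_Ioo] at ht
      rw [hderivφ t ht]; exact hpos' t ht
  -- (b) the three pieces have disjoint images, and `F` is injective on each
  have hlow_im : ∀ z ∈ ball (0 : ℂ) r, z.im < 0 → (F z).im < 0 := fun z hz hzim ↦ by
    have hcz : conj z ∈ W := by
      refine ⟨?_, ?_⟩
      · show 0 < (conj z).im
        rw [Complex.conj_im]; linarith
      · rw [mem_ball_zero_iff, Complex.norm_conj]; exact mem_ball_zero_iff.1 hz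
    rw [hFlow z hzim, Complex.conj_im, neg_lt_zero]
    have h := hFpos _ hcz
    rw [hF_def] at h
    simp only [if_pos (le_of_lt (show 0 < (conj z).im from hcz.1))] at h
    exact h
  have hreal_of : ∀ z ∈ ball (0 : ℂ) r, z.im = 0 → ∃ t : ℝ, t ∈ Ioo (-r) r ∧ z = t := fun z hz hzim ↦ by
    refine ⟨z.re, ?_, Complex.ext (by simp) (by simp [hzim])⟩
    have h1 : |z.re| ≤ ‖z‖ := Complex.abs_re_le_norm z
    have h2 := mem_ball_zero_iff.1 hz
    exact abs_lt.1 (lt_of_le_of_lt h1 h2)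
  intro z₁ hz₁ z₂ hz₂ heq
  rcases lt_trichotomy z₁.im 0 with h1 | h1 | h1 <;> rcases lt_trichotomy z₂.im 0 with h2 | h2 | h2
  · -- both below
    rw [hFlow z₁ h1, hFlow z₂ h2] at heq
    have heq' : G (conj z₁) = G (conj z₂) := by
      have := congrArg conj heq; simpa using this
    have hc₁ : conj z₁ ∈ W := ⟨show 0 < (conj z₁).im by rw [Complex.conj_im]; linarith,
      by rw [mem_ball_zero_iff, Complex.norm_conj]; exact mem_ball_zero_iff.1 hz₁⟩
    have hc₂ : conj z₂ ∈ W := ⟨show 0 < (conj z₂).im by rw [Complex.conj_im]; linarith,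
      by rw [mem_ball_zero_iff, Complex.norm_conj]; exact mem_ball_zero_iff.1 hz₂⟩
    rw [← hEq hc₁, ← hEq hc₂] at heq'
    have := Φ.injOn (hWΩ hc₁) (hWΩ hc₂) heq'
    exact (starRingEnd ℂ).injective this
  · exfalso
    obtain ⟨t, ht, rfl⟩ := hreal_of z₂ hz₂ h2
    have := hlow_im z₁ hz₁ h1
    rw [heq, hFreal t (abs_lt.2 ht)] at this
    exact lt_irrefl _ this
  · exfalso
    have hlt := hlow_im z₁ hz₁ h1
    have hgt := hFpos z₂ ⟨h2, hz₂⟩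
    rw [heq] at hlt
    linarith
  · exfalso
    obtain ⟨t, ht, rfl⟩ := hreal_of z₁ hz₁ h1
    have := hlow_im z₂ hz₂ h2
    rw [← heq, hFreal t (abs_lt.2 ht)] at this
    exact lt_irrefl _ this
  · -- both real
    obtain ⟨t₁, ht₁, rfl⟩ := hreal_of z₁ hz₁ h1
    obtain ⟨t₂, ht₂, rfl⟩ := hreal_of z₂ hz₂ h2
    have : φ t₁ = φ t₂ := by simp only [hφ, heq]
    rw [hφinj ht₁ ht₂ this]
  · exfalso
    obtain ⟨t, ht, rfl⟩ := hreal_of z₁ hz₁ h1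
    have := hFpos z₂ ⟨h2, hz₂⟩
    rw [← heq, hFreal t (abs_lt.2 ht)] at this
    exact lt_irrefl _ this
  · exfalso
    have hgt := hFpos z₁ ⟨h1, hz₁⟩
    have hlt := hlow_im z₂ hz₂ h2
    rw [heq] at hgt
    linarith
  · exfalso
    obtain ⟨t, ht, rfl⟩ := hreal_of z₂ hz₂ h2
    have := hFpos z₁ ⟨h1, hz₁⟩
    rw [heq, hFreal t (abs_lt.2 ht)] at this
    exact lt_irrefl _ this
  · -- both above
    rw [hFW z₁ ⟨h1, hz₁⟩, hFW z₂ ⟨h2, hz₂⟩] at heq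
    exact Φ.injOn (hWΩ ⟨h1, hz₁⟩) (hWΩ ⟨h2, hz₂⟩) heq

end Literature.Probability.RandomPlanarGeometry
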